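import Summits.BirchSwinnertonDyer.BirchSwinnertonDyer.Theorems.PrintCf2SplitBadTwoCMShaLocalScalarInput
import HarnessLib

/-!
# Crux `PrintCf2.SplitBadTwoRankOneOfFacts` (item stmt-BirchSwinnertonDyer-20368), road α, S3c₂: the local input (T-loc) «cyclic `p`-torsion
# of the local Kummer image at `v`» REDUCED TO RATIONAL LOCAL POINTS — «`½(E(K_v) + E[p^∞]) / (E(K_v) + E[p^∞])` has at most two classes»

Cell `bsd-print-cf2`, width seat `bsd-line-cf2-p1-w8` g2 (brick **B6h**, part 3); `--supports stmt-BirchSwinnertonDyer-20368` (helper,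
Theses-free). HONEST FRAMING: nothing here closes a crux or a stub; BSD is not proved by any of this; no summit statement is proved by this
seat. No definition, no named fact, no `sorry`. beyond-print theorem: no.

WHAT. The global route to the CM input of the bottom value (p673910 `sel_input_of_finite_conj`, p674347) needs, besides `hfinB′` and (INF′),
the local statement (T-loc-Sel): «`loc_v(res_⊤ Sel_{p^∞})` has cyclic `p`-torsion» (-w3 g9's hcyc). Every class there is CLASSICAL at `v`, so
it suffices to treat `loc_v(localKerOver p ⊤ K_v)`, the local Kummer image `≅ E(K_v) ⊗ ℚ_p/ℤ_p`; its `p`-torsion is `E(K_v)/(pE(K_v) + E(K_v)_{tors})`,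
of order `p^{[K_v:ℚ_p]} = p` on the frame (`K_v = ℚ₂`, `E(ℚ₂) ≅ ℤ₂ × finite`). This file proves the cohomological statement from a statement
about POINTS:
  (P-cyc) for `R, R′ ∈ E(K̄_v)` with `pR, pR′ ∈ E(K_v) + E[p^∞]`: one of `R`, `R′`, `R′ − R` lies in `E(K_v) + E[p^∞]`
(«the group `{R : pR ∈ E(K_v) + E[p^∞]}/(E(K_v) + E[p^∞]) ≅ E(K_v)/(pE(K_v) + E(K_v)[p^∞])` has at most `p = 2`… at most two elements», the
form in which `E(ℚ₂) ≅ ℤ₂ × finite` delivers it).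
* §1 `resOfLe_oneCocycleClass_eq_zero_of_torsion_coboundary` — a class of `H¹(⊤, E[p^∞])` whose cocycle is `τ ↦ τT − T` on `Γ_{K_v}` for a
  `p`-power TORSION local point `T` dies on `⊤ ⊓ D_v` (`T` is algebraic: `torsionPointsEquiv`; the tail of p670747's proof, isolated).
* §2 `exists_half_rational_of_classical` — a class classical at `v` (cocycle `τ ↦ τR − R`) killed by `p` on `⊤ ⊓ D_v` has `pR ∈ E(K_v) + E[p^∞]`.
* §3 **`loc_localKerOver_cyclic_of_points`** — (T-loc) for `loc_v(localKerOver p ⊤ K_v)` ⟸ (P-cyc); **`loc_sel_cyclic_of_points`** — the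
  (T-loc-Sel) hypothesis of `sel_input_of_finite_conj` / `rBV_of_factor_values_of_finite_conj`, VERBATIM, ⟸ (P-cyc).

References: R. Greenberg, LNM 1716 (1999) §2 Prop. 2.1–2.2 [GreenbergLNM1716]; J. H. Silverman, *AEC* VII.6, VIII.2 [SilvermanAEC2009];
J.-P. Serre, *Galois Cohomology* I §2 [SerreGaloisCohomology1997].
-/

noncomputable section

open scoped Classical

set_option linter.dupNamespace false
set_option autoImplicit false

open NumberField IsDedekindDomain Field
open Literature.NumberTheory.EllipticCurves Literature.NumberTheory.EllipticCurves.GreenbergSelmer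
open Literature.NumberTheory.EllipticCurves.Castella2018.AcSelmer
open Literature.NumberTheory.EllipticCurves.Agboola2007
open Literature.NumberTheory.EllipticCurves.ResKernel
open Literature.NumberTheory.EllipticCurves.Greenberg1999 Literature.NumberTheory.EllipticCurves.CocycleCriteria
open Literature.NumberTheory.GaloisRepresentations
open Summit.BirchSwinnertonDyer.BirchSwinnertonDyer.Theorems.PrintCf2.RestrictedSelmerPair

universe u

namespace Summit.BirchSwinnertonDyer.BirchSwinnertonDyer.Theorems.PrintCf2.CMPrimes

section Local

variable {K : Type u} [Field K] [NumberField K] (V : WeierstrassCurve K) [V.IsElliptic] (p : ℕ) [Fact p.Prime]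
  (v : HeightOneSpectrum (𝓞 K))

/-! ## §1 Torsion coboundaries die on the decomposition group -/

/-- **A cocycle that is the coboundary of a `p`-power torsion local point on `Γ_{K_v}` dies on `⊤ ⊓ D_v`.** If `ι φ(res τ) = τT − T` for all
`τ ∈ Γ_{K_v}` with `p^N T = 0`, then `T` is the image of an algebraic torsion point `t ∈ E[p^∞]` (`torsionPointsEquiv`) and `res_{⊤ ⊓ D_v}[φ] = ∂t = 0`.
(The tail of p670747's `resH1Hom_subtype_mem_awayKer_of_cmScalar`, isolated for reuse.) [cite: SilvermanAEC2009, VII.6, VIII.2]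
[cite: SerreGaloisCohomology1997, I §2.3] -/
theorem resOfLe_oneCocycleClass_eq_zero_of_torsion_coboundary
    (φE : contOneCocycles (discreteTopRep (⊤ : Subgroup (absoluteGaloisGroup K)) ↥(V.geomPrimaryTorsion p)))
    (T : localPoints V (v.adicCompletion K)) (N : ℕ) (hT : ((p ^ N : ℕ) : ℤ) • T = 0)
    (hQT : ∀ x : localSubgroupOfEmb (⊤ : Subgroup (absoluteGaloisGroup K)) (closureEmb (K := K) (v.adicCompletion K)),
      pointsMapOfEmb V (closureEmb (K := K) (v.adicCompletion K))
          ((φE.1 (resGalSubgroupOfEmb ⊤ (closureEmb (K := K) (v.adicCompletion K)) x) : V.geomPrimaryTorsion p) : V.geomPoints) =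
        (x : absoluteGaloisGroup (v.adicCompletion K)) • T - T) :
    Literature.NumberTheory.EllipticCurves.resOfLe ↥(V.geomPrimaryTorsion p) (inf_le_left : ⊤ ⊓ decomp v ≤ ⊤) (oneCocycleClass _ φE) = 0 := by
  set E := v.adicCompletion K with hE
  set ι := closureEmb (K := K) (v.adicCompletion K) with hι
  have hn : ((p ^ N : ℕ) : ℤ) ≠ 0 := by exact_mod_cast (pow_pos (Fact.out : p.Prime).pos _).ne'
  set Tt : AddSubgroup.torsionBy (localPoints V E) ((p ^ N : ℕ) : ℤ) :=
    ⟨T, by change ((p ^ N : ℕ) : ℤ) • T = 0; exact hT⟩ with hTtdef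
  set t : V.geomTorsion ((p ^ N : ℕ) : ℤ) := (V.torsionPointsEquiv ((p ^ N : ℕ) : ℤ) (E := E) hn).symm Tt with htdef
  have ht : pointsMap V E (t : V.geomPoints) = T := by
    rw [htdef, V.pointsMap_torsionPointsEquiv_symm]
  have htp : (t : V.geomPoints) ∈ V.geomPrimaryTorsion p := by
    refine (AddCommGroup.mem_primaryComponent).mpr ⟨N, ?_⟩
    have h2 := t.2
    change ((p ^ N : ℕ) : ℤ) • (t : V.geomPoints) = 0 at h2
    rw [natCast_zsmul] at h2
    exact h2
  rw [Literature.NumberTheory.EllipticCurves.resOfLe, resH1Hom_oneCocycleClass_eq_zero_iff]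
  refine ⟨⟨(t : V.geomPoints), htp⟩, fun g ↦ ?_⟩
  obtain ⟨σ, hσ⟩ := (mem_decomp_iff v (g : absoluteGaloisGroup K)).mp (Subgroup.mem_inf.mp g.2).2
  have h1 := hQT ⟨σ, (mem_localSubgroupOfEmb_iff ⊤ ι σ).mpr (Subgroup.mem_top _)⟩
  have hg : (subgroupInclusion (inf_le_left : ⊤ ⊓ decomp v ≤ ⊤) g : (⊤ : Subgroup (absoluteGaloisGroup K))) =
      resGalSubgroupOfEmb ⊤ ι ⟨σ, (mem_localSubgroupOfEmb_iff ⊤ ι σ).mpr (Subgroup.mem_top _)⟩ := by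
    apply Subtype.ext
    rw [resGalSubgroupOfEmb_apply_coe]
    exact hσ.symm
  apply Subtype.ext
  apply pointsMapOfEmb_injective V ι
  change pointsMapOfEmb V ι ((φE.1 (subgroupInclusion (inf_le_left : ⊤ ⊓ decomp v ≤ ⊤) g) : V.geomPrimaryTorsion p) : V.geomPoints) =
    pointsMapOfEmb V ι (((g • (⟨(t : V.geomPoints), htp⟩ : V.geomPrimaryTorsion p) -
      (⟨(t : V.geomPoints), htp⟩ : V.geomPrimaryTorsion p) : V.geomPrimaryTorsion p) : V.geomPoints))
  rw [hg, h1, AddSubgroupClass.coe_sub, map_sub, Literature.NumberTheory.EllipticCurves.primaryComponent.coe_smul, Subgroup.smul_def]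
  change _ = pointsMapOfEmb V ι ((g : absoluteGaloisGroup K) • (t : V.geomPoints)) - pointsMapOfEmb V ι (t : V.geomPoints)
  rw [← hσ]
  change _ = pointsMap V E (resGal (K := K) E σ • (t : V.geomPoints)) - pointsMap V E (t : V.geomPoints)
  rw [pointsMap_smul, ht]

/-! ## §2 Classical classes: the point `R` behind the cocycle, and `pR` when the class is killed by `p` locally -/

omit [V.IsElliptic] [Fact p.Prime] in
/-- **The classical condition at `v` on a cocycle**: `[φ] ∈ localKerOver p ⊤ K_v` iff-direction «∃ `R ∈ E(K̄_v)` with `ι φ(res τ) = τR − R`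
on `Γ_{K_v}`». [cite: GreenbergLNM1716, §2] -/
theorem exists_point_of_mem_localKerOver
    (φE : contOneCocycles (discreteTopRep (⊤ : Subgroup (absoluteGaloisGroup K)) ↥(V.geomPrimaryTorsion p)))
    (hc : oneCocycleClass _ φE ∈ V.localKerOver p ⊤ (v.adicCompletion K)) :
    ∃ R : localPoints V (v.adicCompletion K),
      ∀ x : localSubgroupOfEmb (⊤ : Subgroup (absoluteGaloisGroup K)) (closureEmb (K := K) (v.adicCompletion K)),
        pointsMapOfEmb V (closureEmb (K := K) (v.adicCompletion K))
            ((φE.1 (resGalSubgroupOfEmb ⊤ (closureEmb (K := K) (v.adicCompletion K)) x) : V.geomPrimaryTorsion p) : V.geomPoints) =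
          (x : absoluteGaloisGroup (v.adicCompletion K)) • R - R := by
  set ι := closureEmb (K := K) (v.adicCompletion K) with hι
  have hc' : resH1Hom (resGalSubgroupOfEmb ⊤ ι) ((pointsMapOfEmb V ι).comp (V.geomPrimaryTorsion p).subtype)
      (fun τ P ↦ by
        simp only [AddMonoidHom.coe_comp, AddSubgroup.coe_subtype, Function.comp_apply, Subgroup.smul_def,
          resGalSubgroupOfEmb_apply_coe, Literature.NumberTheory.EllipticCurves.primaryComponent.coe_smul]
        exact pointsMapOfEmb_smul V ι τ P)
      (oneCocycleClass _ φE) = 0 := hc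
  rw [resH1Hom_oneCocycleClass_eq_zero_iff] at hc'
  obtain ⟨Q, hQ⟩ := hc'
  exact ⟨Q, fun x ↦ hQ x⟩

omit [V.IsElliptic] [Fact p.Prime] in
/-- **If the class is killed by `p` on `⊤ ⊓ D_v` then `pR ∈ E(K_v) + E[p^∞]`**: `p • res_v[φ] = 0` gives `t ∈ E[p^∞]` with
`p φ(g) = g t − t` on `⊤ ⊓ D_v`, and then `τ(pR − ι t) = pR − ι t` for all `τ ∈ Γ_{K_v}`. [cite: GreenbergLNM1716, §2 Prop. 2.1]
[cite: SerreGaloisCohomology1997, I §2.3] -/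
theorem exists_half_rational_of_classical
    (φE : contOneCocycles (discreteTopRep (⊤ : Subgroup (absoluteGaloisGroup K)) ↥(V.geomPrimaryTorsion p)))
    (R : localPoints V (v.adicCompletion K))
    (hR : ∀ x : localSubgroupOfEmb (⊤ : Subgroup (absoluteGaloisGroup K)) (closureEmb (K := K) (v.adicCompletion K)),
        pointsMapOfEmb V (closureEmb (K := K) (v.adicCompletion K))
            ((φE.1 (resGalSubgroupOfEmb ⊤ (closureEmb (K := K) (v.adicCompletion K)) x) : V.geomPrimaryTorsion p) : V.geomPoints) =
          (x : absoluteGaloisGroup (v.adicCompletion K)) • R - R)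
    (hp : p • Literature.NumberTheory.EllipticCurves.resOfLe ↥(V.geomPrimaryTorsion p) (inf_le_left : ⊤ ⊓ decomp v ≤ ⊤)
        (oneCocycleClass _ φE) = 0) :
    ∃ (Q t : localPoints V (v.adicCompletion K)),
      (∀ σ : absoluteGaloisGroup (v.adicCompletion K), σ • Q = Q) ∧ (∃ k : ℕ, p ^ k • t = 0) ∧ p • R = Q + t := by
  set E := v.adicCompletion K with hE
  set ι := closureEmb (K := K) (v.adicCompletion K) with hι
  -- `p • res[φ] = res[(p : ℤ) • φ]`
  have hcl : Literature.NumberTheory.EllipticCurves.resOfLe ↥(V.geomPrimaryTorsion p) (inf_le_left : ⊤ ⊓ decomp v ≤ ⊤)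
      (oneCocycleClass _ (((p : ℕ) : ℤ) • φE)) = 0 := by
    rw [(oneCocycleClass_smul _ ((p : ℕ) : ℤ) φE).trans (Int.cast_smul_eq_zsmul ℤ ((p : ℕ) : ℤ) _), natCast_zsmul, map_nsmul, hp]
  rw [Literature.NumberTheory.EllipticCurves.resOfLe, resH1Hom_oneCocycleClass_eq_zero_iff] at hcl
  obtain ⟨t, htg⟩ := hcl
  -- the torsion point `ι t` and the rational point `pR - ι t`
  obtain ⟨k, hk⟩ := (AddCommGroup.mem_primaryComponent).mp t.2
  refine ⟨p • R - pointsMap V E (t : V.geomPoints), pointsMap V E (t : V.geomPoints), fun σ ↦ ?_,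
    ⟨k, by rw [← map_nsmul, hk, map_zero]⟩, (sub_add_cancel _ _).symm⟩
  -- `σ(pR) - pR = p (σR - R) = ι (p φ)(res σ) = ι (g t - t) = σ ι t - ι t`
  have hσmem : absGaloisRestrict K E σ ∈ (⊤ ⊓ decomp v : Subgroup (absoluteGaloisGroup K)) :=
    Subgroup.mem_inf.mpr ⟨Subgroup.mem_top _, (mem_decomp_iff v _).mpr ⟨σ, rfl⟩⟩
  have h1 := htg ⟨absGaloisRestrict K E σ, hσmem⟩
  have h2 := hR ⟨σ, (mem_localSubgroupOfEmb_iff ⊤ ι σ).mpr (Subgroup.mem_top _)⟩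
  -- unpack `((p : ℤ) • φ).1 g = (p : ℤ) • φ.1 g`
  have h3 : ((((p : ℕ) : ℤ) • φE).1 (subgroupInclusion (inf_le_left : ⊤ ⊓ decomp v ≤ ⊤) ⟨absGaloisRestrict K E σ, hσmem⟩) :
      V.geomPrimaryTorsion p) = p • φE.1 (resGalSubgroupOfEmb ⊤ ι ⟨σ, (mem_localSubgroupOfEmb_iff ⊤ ι σ).mpr (Subgroup.mem_top _)⟩) := by
    rw [Submodule.coe_smul, ContinuousMap.smul_apply, natCast_zsmul]
    rfl
  have h1' : ((((p : ℕ) : ℤ) • φE).1 (subgroupInclusion (inf_le_left : ⊤ ⊓ decomp v ≤ ⊤) ⟨absGaloisRestrict K E σ, hσmem⟩) :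
      V.geomPrimaryTorsion p) =
      (⟨absGaloisRestrict K E σ, hσmem⟩ : (⊤ ⊓ decomp v : Subgroup (absoluteGaloisGroup K))) • t - t := h1
  have h2' : pointsMap V E ((φE.1 (resGalSubgroupOfEmb ⊤ ι ⟨σ, (mem_localSubgroupOfEmb_iff ⊤ ι σ).mpr (Subgroup.mem_top _)⟩) :
      V.geomPrimaryTorsion p) : V.geomPoints) = σ • R - R := h2
  have key : p • (σ • R - R) = σ • pointsMap V E (t : V.geomPoints) - pointsMap V E (t : V.geomPoints) := by
    rw [← h2', ← map_nsmul, ← AddSubmonoidClass.coe_nsmul, ← h3, h1', AddSubgroupClass.coe_sub, map_sub,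
      Literature.NumberTheory.EllipticCurves.primaryComponent.coe_smul, Subgroup.smul_def]
    change pointsMap V E (resGal (K := K) E σ • (t : V.geomPoints)) - _ = _
    rw [pointsMap_smul]
  have e1 : σ • (p • R) = p • R + (σ • pointsMap V E (t : V.geomPoints) - pointsMap V E (t : V.geomPoints)) := by
    rw [← key, smul_sub, smul_comm σ p R]
    abel
  rw [smul_sub, e1]
  abel

/-! ## §3 (T-loc) from (P-cyc) -/

/-- **Cyclic `p`-torsion of the local Kummer image at `v`, from points.** (P-cyc): for `R, R′ ∈ E(K̄_v)` with `pR, pR′ ∈ E(K_v) + E[p^∞]`,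
one of `R`, `R′`, `R′ − R` lies in `E(K_v) + E[p^∞]` («`½(E(K_v)+E[p^∞])/(E(K_v)+E[p^∞]) ≅ E(K_v)/(pE(K_v) + E(K_v)[p^∞])` has at most two
classes» — `E(ℚ₂) ≅ ℤ₂ × finite` at `p = 2`). THEN every two classes `x ≠ 0`, `y` of `loc_v(localKerOver p ⊤ K_v)` killed by `p` satisfy
`y ∈ ℤ·x`. (A class classical at `v` is `τ ↦ τR − R`; killed by `p` locally gives `pR ∈ E(K_v) + E[p^∞]` (§2); a torsion-translate of a
rational point gives a torsion coboundary, which dies on `D_v` (§1).) [cite: GreenbergLNM1716, §2 Prop. 2.1–2.2] [cite: SilvermanAEC2009, VIII.2] -/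
theorem loc_localKerOver_cyclic_of_points
    (Hcyc : ∀ R R' : localPoints V (v.adicCompletion K),
      (∃ Q t : localPoints V (v.adicCompletion K), (∀ σ : absoluteGaloisGroup (v.adicCompletion K), σ • Q = Q) ∧
        (∃ k : ℕ, p ^ k • t = 0) ∧ p • R = Q + t) →
      (∃ Q t : localPoints V (v.adicCompletion K), (∀ σ : absoluteGaloisGroup (v.adicCompletion K), σ • Q = Q) ∧
        (∃ k : ℕ, p ^ k • t = 0) ∧ p • R' = Q + t) →
      (∃ t : localPoints V (v.adicCompletion K), (∃ k : ℕ, p ^ k • t = 0) ∧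
          ∀ σ : absoluteGaloisGroup (v.adicCompletion K), σ • (R - t) = R - t) ∨
        (∃ t : localPoints V (v.adicCompletion K), (∃ k : ℕ, p ^ k • t = 0) ∧
          ∀ σ : absoluteGaloisGroup (v.adicCompletion K), σ • (R' - t) = R' - t) ∨
        (∃ t : localPoints V (v.adicCompletion K), (∃ k : ℕ, p ^ k • t = 0) ∧
          ∀ σ : absoluteGaloisGroup (v.adicCompletion K), σ • (R' - R - t) = R' - R - t)) :
    ∀ x ∈ (V.localKerOver p ⊤ (v.adicCompletion K)).map
        (Literature.NumberTheory.EllipticCurves.resOfLe ↥(V.geomPrimaryTorsion p) (inf_le_left : ⊤ ⊓ decomp v ≤ ⊤)),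
      ∀ y ∈ (V.localKerOver p ⊤ (v.adicCompletion K)).map
        (Literature.NumberTheory.EllipticCurves.resOfLe ↥(V.geomPrimaryTorsion p) (inf_le_left : ⊤ ⊓ decomp v ≤ ⊤)),
      p • x = 0 → p • y = 0 → x ≠ 0 → ∃ m : ℤ, y = m • x := by
  set E := v.adicCompletion K with hE
  set ι := closureEmb (K := K) (v.adicCompletion K) with hι
  intro x hx y hy hpx hpy hx0
  obtain ⟨ηx, hηx, rfl⟩ := AddSubgroup.mem_map.mp hx
  obtain ⟨ηy, hηy, rfl⟩ := AddSubgroup.mem_map.mp hy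
  obtain ⟨φx, rfl⟩ := oneCocycleClass_surjective _ ηx
  obtain ⟨φy, rfl⟩ := oneCocycleClass_surjective _ ηy
  obtain ⟨Rx, hRx⟩ := exists_point_of_mem_localKerOver V p v φx hηx
  obtain ⟨Ry, hRy⟩ := exists_point_of_mem_localKerOver V p v φy hηy
  have hhx := exists_half_rational_of_classical V p v φx Rx hRx hpx
  have hhy := exists_half_rational_of_classical V p v φy Ry hRy hpy
  -- a torsion-translate of a rational point gives a torsion coboundary, which dies on `D_v`
  have vanish : ∀ (φ : contOneCocycles (discreteTopRep (⊤ : Subgroup (absoluteGaloisGroup K)) ↥(V.geomPrimaryTorsion p)))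
      (R : localPoints V E),
      (∀ xσ : localSubgroupOfEmb (⊤ : Subgroup (absoluteGaloisGroup K)) ι,
        pointsMapOfEmb V ι ((φ.1 (resGalSubgroupOfEmb ⊤ ι xσ) : V.geomPrimaryTorsion p) : V.geomPoints) =
          (xσ : absoluteGaloisGroup E) • R - R) →
      (∃ t : localPoints V E, (∃ k : ℕ, p ^ k • t = 0) ∧ ∀ σ : absoluteGaloisGroup E, σ • (R - t) = R - t) →
      Literature.NumberTheory.EllipticCurves.resOfLe ↥(V.geomPrimaryTorsion p) (inf_le_left : ⊤ ⊓ decomp v ≤ ⊤)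
        (oneCocycleClass _ φ) = 0 := by
    rintro φ R hR ⟨t, ⟨k, hk⟩, hrat⟩
    refine resOfLe_oneCocycleClass_eq_zero_of_torsion_coboundary V p v φ t k (by rw [natCast_zsmul]; exact hk) (fun xσ ↦ ?_)
    rw [hR xσ]
    have h := hrat (xσ : absoluteGaloisGroup E)
    rw [smul_sub] at h
    exact sub_eq_sub_iff_sub_eq_sub.mp h
  rcases Hcyc Rx Ry hhx hhy with hA | hB | hC
  · exact absurd (vanish φx Rx hRx hA) hx0
  · exact ⟨0, by rw [zero_zsmul]; exact vanish φy Ry hRy hB⟩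
  · refine ⟨1, ?_⟩
    rw [one_zsmul]
    have hsub : Literature.NumberTheory.EllipticCurves.resOfLe ↥(V.geomPrimaryTorsion p) (inf_le_left : ⊤ ⊓ decomp v ≤ ⊤)
        (oneCocycleClass _ (φy - φx)) = 0 := by
      refine vanish (φy - φx) (Ry - Rx) (fun xσ ↦ ?_) hC
      rw [Submodule.coe_sub, ContinuousMap.sub_apply, AddSubgroupClass.coe_sub, map_sub, hRx xσ, hRy xσ, smul_sub]
      abel
    have hcls : oneCocycleClass _ (φy - φx) =
        oneCocycleClass (discreteTopRep (⊤ : Subgroup (absoluteGaloisGroup K)) ↥(V.geomPrimaryTorsion p)) φy -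
          oneCocycleClass _ φx :=
      eq_sub_of_add_eq (by rw [← oneCocycleClass_add, sub_add_cancel])
    rw [hcls, map_sub, sub_eq_zero] at hsub
    exact hsub

/-- **(T-loc-Sel) from (P-cyc)** — the hypothesis `hcyc` of `sel_input_of_finite_conj` (p673910) / the third conjunct of `hConj` in
`rBV_of_factor_values_of_finite_conj`, VERBATIM: restrictions of Selmer classes are classical at `v`. [cite: GreenbergLNM1716, §2 Prop. 2.1–2.2] -/
theorem loc_sel_cyclic_of_points
    (Hcyc : ∀ R R' : localPoints V (v.adicCompletion K),
      (∃ Q t : localPoints V (v.adicCompletion K), (∀ σ : absoluteGaloisGroup (v.adicCompletion K), σ • Q = Q) ∧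
        (∃ k : ℕ, p ^ k • t = 0) ∧ p • R = Q + t) →
      (∃ Q t : localPoints V (v.adicCompletion K), (∀ σ : absoluteGaloisGroup (v.adicCompletion K), σ • Q = Q) ∧
        (∃ k : ℕ, p ^ k • t = 0) ∧ p • R' = Q + t) →
      (∃ t : localPoints V (v.adicCompletion K), (∃ k : ℕ, p ^ k • t = 0) ∧
          ∀ σ : absoluteGaloisGroup (v.adicCompletion K), σ • (R - t) = R - t) ∨
        (∃ t : localPoints V (v.adicCompletion K), (∃ k : ℕ, p ^ k • t = 0) ∧
          ∀ σ : absoluteGaloisGroup (v.adicCompletion K), σ • (R' - t) = R' - t) ∨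
        (∃ t : localPoints V (v.adicCompletion K), (∃ k : ℕ, p ^ k • t = 0) ∧
          ∀ σ : absoluteGaloisGroup (v.adicCompletion K), σ • (R' - R - t) = R' - R - t)) :
    ∀ x ∈ ((V.selmerGroupPInfty p).map (resSubgroup ⊤ (V.geomPrimaryTorsion p))).map
        (Literature.NumberTheory.EllipticCurves.resOfLe (V.geomPrimaryTorsion p) (inf_le_left : ⊤ ⊓ decomp v ≤ ⊤)),
      ∀ y ∈ ((V.selmerGroupPInfty p).map (resSubgroup ⊤ (V.geomPrimaryTorsion p))).map
        (Literature.NumberTheory.EllipticCurves.resOfLe (V.geomPrimaryTorsion p) (inf_le_left : ⊤ ⊓ decomp v ≤ ⊤)),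
      p • x = 0 → p • y = 0 → x ≠ 0 → ∃ m : ℤ, y = m • x := by
  have hle : (V.selmerGroupPInfty p).map (resSubgroup ⊤ (V.geomPrimaryTorsion p)) ≤ V.localKerOver p ⊤ (v.adicCompletion K) := by
    intro w hw
    obtain ⟨z, hz, rfl⟩ := AddSubgroup.mem_map.mp hw
    simp only [WeierstrassCurve.selmerGroupPInfty, AddSubgroup.mem_inf, AddSubgroup.mem_iInf] at hz
    exact V.resSubgroup_top_mem_localKerOver (hz.1 v)
  intro x hx y hy
  exact loc_localKerOver_cyclic_of_points V p v Hcyc x (AddSubgroup.map_mono hle hx) y (AddSubgroup.map_mono hle hy)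

end Local

end Summit.BirchSwinnertonDyer.BirchSwinnertonDyer.Theorems.PrintCf2.CMPrimes

end
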